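import Mathlib

/-!
# SoloBlind — Dickson polynomials mod 2: constant and linear coefficients

In the supersingular/CM model of the 2-Eisenstein part of the Hecke algebra at prime
level `N ≡ 1 (mod 8)` (COROLLARY S of the seat's notes), a Hecke operator `T_l` for a
prime `l` split in `ℚ(√-N)` acts as `σ^d + σ^{-d} = D_d(Y)`, where `Y = σ + σ⁻¹`,
`D_d` is the Dickson polynomial `Polynomial.dickson 1 1 d` and `d` is the discrete
logarithm of the class of a prime above `l` in the cyclic group `Cl(-4N)[2^∞]`.
The two facts below — over `ZMod 2`, `D_d` has zero constant term and its linear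
coefficient is `d mod 2` — say that `T_l - l - 1` lies in the maximal ideal and is a
uniformiser iff `d` is odd, which (by genus theory, `d` odd iff `l ≡ 3 mod 4`) is the
first-order statement of Calegari–Emerton, *On the ramification of Hecke algebras at
Eisenstein primes*, Prop. 4.11 (i).
-/

namespace Summit.Langlands.Langlands.Theorems

open Polynomial

/-- Over `ZMod 2` the Dickson polynomial `D_n = dickson 1 1 n` (so `D_0 = 2`, `D_1 = X`,
`D_{n+2} = X D_{n+1} - D_n`) has constant coefficient `0` and linear coefficient `n`. -/
theorem soloBlind_dickson_mod2_coeff :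
    ∀ n : ℕ, (dickson 1 (1 : ZMod 2) n).coeff 0 = 0 ∧
      (dickson 1 (1 : ZMod 2) n).coeff 1 = (n : ZMod 2)
  | 0 => by
      have h : dickson 1 (1 : ZMod 2) 0 = C (2 : ZMod 2) := by
        rw [dickson_zero]; norm_num [map_ofNat]
      have h2 : (2 : ZMod 2) = 0 := by decide
      rw [h, h2, map_zero]
      simp
  | 1 => by
      rw [dickson_one]
      simp
  | (n + 2) => by
      obtain ⟨h0, h1⟩ := soloBlind_dickson_mod2_coeff n
      obtain ⟨h0', _⟩ := soloBlind_dickson_mod2_coeff (n + 1)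
      rw [dickson_add_two, C_1, one_mul]
      refine ⟨?_, ?_⟩
      · rw [coeff_sub, coeff_X_mul_zero, h0, sub_zero]
      · rw [coeff_sub, coeff_X_mul, h0', h1]
        have h2 : (2 : ZMod 2) = 0 := by decide
        push_cast
        linear_combination (-(n : ZMod 2) - 1) * h2

/-- Consequently `D_n` evaluated at `0` vanishes mod 2: `T_l - (l + 1)` acts nilpotently. -/
theorem soloBlind_dickson_mod2_eval_zero (n : ℕ) :
    (dickson 1 (1 : ZMod 2) n).eval 0 = 0 := by
  rw [← coeff_zero_eq_eval_zero]
  exact (soloBlind_dickson_mod2_coeff n).1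

end Summit.Langlands.Langlands.Theorems
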